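import Mathlib.Data.Real.Basic
import Mathlib.Algebra.Module.Basic
import Mathlib.Tactic.Linarith
import Mathlib.Tactic.Positivity
import Mathlib.Tactic.FieldSimp
import Mathlib.Tactic.Ring
import Mathlib.Tactic.LinearCombination
import Summits.NavierStokesRegularity.TurbBounds.Cutoff
import HarnessLib

/-!
# Parity–Squire reduction of the 3-D spectral constraint for planar shear flows (lemma R-SQ of the pub-turb cell)

Cell `turb-bounds` (pub-turb), seat pub-turb-shear; file of record `run/shared/lean/pub/pub-turb/CERT-SHEAR.md` §10.
HONEST FRAMING: rigorous bounds for the stated PDE and boundary conditions; no claim about physical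
turbulence beyond the bound.

Background (cited, NOT formalised here): for plane Couette flow the background-method spectral constraint at
Reynolds number `Re` is, wavevector by wavevector `𝐤 = (j, k)`, `κ² = j² + k²`, the non-negativity of a quadratic
form `Q³ᴰ` in the poloidal/toroidal Fourier amplitudes `(φ̂, ψ̂)` [RZG25 = Rajkotia–Zaheer–Goluskin, JFM 2025,
arXiv:2503.04005, §2.3 and App. 'Proof of Busse's theorem'; Busse, Arch. Rational Mech. Anal. 47 (1972) 28–35].
Splitting the amplitudes by parity in the wall-normal coordinate (`φ̂ = φₑ + φₒ`, `ψ̂ = ψₑ + ψₒ`; the coefficient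
`h = (aU′+ζ′)/(a−1)` is EVEN) the form reads, with `E, F ≥ 0` the dissipations and `X, Y` the production couplings,
`Q³ᴰ = c·κ²·(E φₑ + E φₒ + F ψₑ + F ψₒ) + Re·κ²·( k·X ψₑ φₑ + k·X ψₒ φₒ + j·Y φₑ φₒ )`,
while the three ONE-dimensional families certified by LMIs are
* 2.5-D even / odd sector at `(κ, R)`:  `c·(E φ + F ψ) + R·κ·X ψ φ ≥ 0`,
* 2-D (spanwise-invariant, purely poloidal) at `(κ, R)`:  `c·(E φₑ + E φₒ) + R·κ·Y φₑ φₒ ≥ 0`.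

What IS formalised (no PDE, no integrals): the reduction is an identity between these quadratic expressions plus
three rescalings of the test amplitudes, valid for ANY real vector spaces of amplitudes and ANY functionals with the
stated homogeneity under real scalings (`E, F` 2-homogeneous, `X, Y` 1-homogeneous in each argument; these are
binders of the theorems, not definitions). Theorem
`squire_parity_reduction`: if the even sector holds at `Re`, the odd sector at `Rₒ` with `Rₒ·s = Re`, and the 2-D
family at `Rₚ` with `Rₚ·t = Re`, where `0 < s, 0 < t, s² + t² ≤ 1` (Busse's `β = s²`), then `Q³ᴰ ≥ 0` at every
wavevector with `j² + k² = κ²`. The axis cases (`j = 0`: plain 2.5-D; `k = 0`: plain 2-D at `Re`) are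
`squire_parity_axis_k` / `squire_parity_axis_j`. `busse_split_exists` is the scalar bookkeeping
`Re²(1/Rₒ² + 1/Rₚ²) ≤ 1 ⇒ ∃ s t …` (RZG25 eq. (χ ≤ 1)), and `poloidal_free` is the scalar core of the
wavenumber cutoff of the 2-D family (CERT-SHEAR §10 (Φ-cutoff)), an instance of `quad_core` (Cutoff.lean);
`interval_rule_monotone_affine` is the scalar core of the cell rule R-I‴ (two endpoint LMIs per wavenumber cell).
The identification of `E, F, X, Y` with the integrals of RZG25 App. A / CERT-SHEAR §10 is the part left on paper.
-/

namespace Summit.NavierStokesRegularity.TurbBounds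

section Reduction

/-- **Lemma R-SQ (parity–Squire reduction), abstract form.** Amplitude spaces: `Ve/Vo` even/odd poloidal,
`We/Wo` even/odd toroidal. Data: dissipations `Ee, Eo, Fe, Fo` (2-homogeneous, `Eo ≥ 0`), couplings `Xe, Xo`
(toroidal–poloidal, same parity) and `Y` (poloidal even–odd), all 1-homogeneous in each slot; `0 ≤ c`.
Hypotheses: the 2.5-D EVEN sector at Reynolds number `Re`, the 2.5-D ODD sector at `Ro` with `Ro·s = Re`, the
2-D poloidal family at `Rp` with `Rp·t = Re`, all at the same wavenumber modulus `κ`, with `s² + t² ≤ 1`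
(in the application `s = √β > 0`, `t = √(1−β) > 0`; positivity is not needed for the inequality). Conclusion: the 3-D form at any wavevector `(j, k)` with `j² + k² = κ²` is non-negative.
Proof: evaluate the three hypotheses at the rescaled amplitudes `(k•φₑ, κ•ψₑ)`, `((k s)•φₒ, κ•ψₒ)`,
`(j•φₑ, (κ t)•φₒ)` and add; the remainder is `c·((1−s²−t²)κ² + s²j²)·Eo φₒ ≥ 0`. -/
theorem squire_parity_reduction
    {Ve Vo We Wo : Type*} [AddCommGroup Ve] [Module ℝ Ve] [AddCommGroup Vo] [Module ℝ Vo]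
    [AddCommGroup We] [Module ℝ We] [AddCommGroup Wo] [Module ℝ Wo]
    (Ee : Ve → ℝ) (Eo : Vo → ℝ) (Fe : We → ℝ) (Fo : Wo → ℝ)
    (Xe : We → Ve → ℝ) (Xo : Wo → Vo → ℝ) (Y : Ve → Vo → ℝ)
    (hEe : ∀ (r : ℝ) (v : Ve), Ee (r • v) = r ^ 2 * Ee v) (hEo : ∀ (r : ℝ) (v : Vo), Eo (r • v) = r ^ 2 * Eo v)
    (hFe : ∀ (r : ℝ) (w : We), Fe (r • w) = r ^ 2 * Fe w) (hFo : ∀ (r : ℝ) (w : Wo), Fo (r • w) = r ^ 2 * Fo w)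
    (hXe : ∀ (r u : ℝ) (w : We) (v : Ve), Xe (r • w) (u • v) = r * u * Xe w v)
    (hXo : ∀ (r u : ℝ) (w : Wo) (v : Vo), Xo (r • w) (u • v) = r * u * Xo w v)
    (hY : ∀ (r u : ℝ) (v : Ve) (v' : Vo), Y (r • v) (u • v') = r * u * Y v v')
    (hEo_nn : ∀ v, 0 ≤ Eo v)
    {c Re Ro Rp κ s t : ℝ} (hc : 0 ≤ c) (hst : s ^ 2 + t ^ 2 ≤ 1)
    (hRo : Ro * s = Re) (hRp : Rp * t = Re)
    (HE : ∀ (φ : Ve) (ψ : We), 0 ≤ c * (Ee φ + Fe ψ) + Re * κ * Xe ψ φ)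
    (HO : ∀ (φ : Vo) (ψ : Wo), 0 ≤ c * (Eo φ + Fo ψ) + Ro * κ * Xo ψ φ)
    (HP : ∀ (φ : Ve) (φ' : Vo), 0 ≤ c * (Ee φ + Eo φ') + Rp * κ * Y φ φ')
    {j k : ℝ} (hjk : j ^ 2 + k ^ 2 = κ ^ 2) (φe : Ve) (φo : Vo) (ψe : We) (ψo : Wo) :
    0 ≤ c * (κ ^ 2 * (Ee φe + Eo φo + Fe ψe + Fo ψo))
        + Re * κ ^ 2 * (k * Xe ψe φe + k * Xo ψo φo + j * Y φe φo) := by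
  have h1 := HE (k • φe) (κ • ψe)
  have h2 := HO ((k * s) • φo) (κ • ψo)
  have h3 := HP (j • φe) ((κ * t) • φo)
  rw [hEe, hFe, hXe] at h1
  rw [hEo, hFo, hXo] at h2
  rw [hEe, hEo, hY] at h3
  have hA : 0 ≤ c * Eo φo := mul_nonneg hc (hEo_nn φo)
  have hB : 0 ≤ (1 - s ^ 2 - t ^ 2) * κ ^ 2 + s ^ 2 * j ^ 2 :=
    add_nonneg (mul_nonneg (by linarith) (sq_nonneg κ)) (mul_nonneg (sq_nonneg s) (sq_nonneg j))
  have hC : 0 ≤ c * Eo φo * ((1 - s ^ 2 - t ^ 2) * κ ^ 2 + s ^ 2 * j ^ 2) := mul_nonneg hA hB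
  have key : c * (κ ^ 2 * (Ee φe + Eo φo + Fe ψe + Fo ψo))
        + Re * κ ^ 2 * (k * Xe ψe φe + k * Xo ψo φo + j * Y φe φo)
      = (c * (k ^ 2 * Ee φe + κ ^ 2 * Fe ψe) + Re * κ * (κ * k * Xe ψe φe))
        + (c * ((k * s) ^ 2 * Eo φo + κ ^ 2 * Fo ψo) + Ro * κ * (κ * (k * s) * Xo ψo φo))
        + (c * (j ^ 2 * Ee φe + (κ * t) ^ 2 * Eo φo) + Rp * κ * (j * (κ * t) * Y φe φo))
        + c * Eo φo * ((1 - s ^ 2 - t ^ 2) * κ ^ 2 + s ^ 2 * j ^ 2) := by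
    linear_combination (-(c * Ee φe) - c * Eo φo * s ^ 2) * hjk
      - (κ ^ 2 * k * Xo ψo φo) * hRo - (κ ^ 2 * j * Y φe φo) * hRp
  rw [key]
  linarith

/-- Axis case `j = 0` (streamwise-invariant wavevectors): the 3-D form at `(0, k)`, `k² = κ²`, is the sum of the
two 2.5-D parity sectors at the SAME Reynolds number — no split parameter is needed. -/
theorem squire_parity_axis_k
    {Ve Vo We Wo : Type*} [AddCommGroup Ve] [Module ℝ Ve] [AddCommGroup Vo] [Module ℝ Vo]
    [AddCommGroup We] [Module ℝ We] [AddCommGroup Wo] [Module ℝ Wo]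
    (Ee : Ve → ℝ) (Eo : Vo → ℝ) (Fe : We → ℝ) (Fo : Wo → ℝ)
    (Xe : We → Ve → ℝ) (Xo : Wo → Vo → ℝ) (Y : Ve → Vo → ℝ)
    (hEe : ∀ (r : ℝ) (v : Ve), Ee (r • v) = r ^ 2 * Ee v) (hEo : ∀ (r : ℝ) (v : Vo), Eo (r • v) = r ^ 2 * Eo v)
    (hFe : ∀ (r : ℝ) (w : We), Fe (r • w) = r ^ 2 * Fe w) (hFo : ∀ (r : ℝ) (w : Wo), Fo (r • w) = r ^ 2 * Fo w)
    (hXe : ∀ (r u : ℝ) (w : We) (v : Ve), Xe (r • w) (u • v) = r * u * Xe w v)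
    (hXo : ∀ (r u : ℝ) (w : Wo) (v : Vo), Xo (r • w) (u • v) = r * u * Xo w v)
    {c Re κ : ℝ}
    (HE : ∀ (φ : Ve) (ψ : We), 0 ≤ c * (Ee φ + Fe ψ) + Re * κ * Xe ψ φ)
    (HO : ∀ (φ : Vo) (ψ : Wo), 0 ≤ c * (Eo φ + Fo ψ) + Re * κ * Xo ψ φ)
    {k : ℝ} (hk : k ^ 2 = κ ^ 2) (φe : Ve) (φo : Vo) (ψe : We) (ψo : Wo) :
    0 ≤ c * (κ ^ 2 * (Ee φe + Eo φo + Fe ψe + Fo ψo))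
        + Re * κ ^ 2 * (k * Xe ψe φe + k * Xo ψo φo + 0 * Y φe φo) := by
  have h1 := HE (k • φe) (κ • ψe)
  have h2 := HO (k • φo) (κ • ψo)
  rw [hEe, hFe, hXe] at h1
  rw [hEo, hFo, hXo] at h2
  have key : c * (κ ^ 2 * (Ee φe + Eo φo + Fe ψe + Fo ψo))
        + Re * κ ^ 2 * (k * Xe ψe φe + k * Xo ψo φo + 0 * Y φe φo)
      = (c * (k ^ 2 * Ee φe + κ ^ 2 * Fe ψe) + Re * κ * (κ * k * Xe ψe φe))
        + (c * (k ^ 2 * Eo φo + κ ^ 2 * Fo ψo) + Re * κ * (κ * k * Xo ψo φo)) := by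
    linear_combination (-(c * Ee φe) - c * Eo φo) * hk
  rw [key]
  linarith

/-- Axis case `k = 0` (spanwise-invariant wavevectors): the 3-D form at `(j, 0)`, `j² = κ²`, follows from the
2-D poloidal family at the SAME Reynolds number plus non-negativity of the toroidal dissipations. -/
theorem squire_parity_axis_j
    {Ve Vo We Wo : Type*} [AddCommGroup Ve] [Module ℝ Ve] [AddCommGroup Vo] [Module ℝ Vo]
    (Ee : Ve → ℝ) (Eo : Vo → ℝ) (Fe : We → ℝ) (Fo : Wo → ℝ)
    (Xe : We → Ve → ℝ) (Xo : Wo → Vo → ℝ) (Y : Ve → Vo → ℝ)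
    (hEe : ∀ (r : ℝ) (v : Ve), Ee (r • v) = r ^ 2 * Ee v) (hEo : ∀ (r : ℝ) (v : Vo), Eo (r • v) = r ^ 2 * Eo v)
    (hY : ∀ (r u : ℝ) (v : Ve) (v' : Vo), Y (r • v) (u • v') = r * u * Y v v')
    (hFe_nn : ∀ w, 0 ≤ Fe w) (hFo_nn : ∀ w, 0 ≤ Fo w)
    {c Re κ : ℝ} (hc : 0 ≤ c)
    (HP : ∀ (φ : Ve) (φ' : Vo), 0 ≤ c * (Ee φ + Eo φ') + Re * κ * Y φ φ')
    {j : ℝ} (hj : j ^ 2 = κ ^ 2) (φe : Ve) (φo : Vo) (ψe : We) (ψo : Wo) :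
    0 ≤ c * (κ ^ 2 * (Ee φe + Eo φo + Fe ψe + Fo ψo))
        + Re * κ ^ 2 * (0 * Xe ψe φe + 0 * Xo ψo φo + j * Y φe φo) := by
  have h3 := HP (j • φe) (κ • φo)
  rw [hEe, hEo, hY] at h3
  have hF : 0 ≤ c * (κ ^ 2 * (Fe ψe + Fo ψo)) :=
    mul_nonneg hc (mul_nonneg (sq_nonneg κ) (add_nonneg (hFe_nn ψe) (hFo_nn ψo)))
  have key : c * (κ ^ 2 * (Ee φe + Eo φo + Fe ψe + Fo ψo))
        + Re * κ ^ 2 * (0 * Xe ψe φe + 0 * Xo ψo φo + j * Y φe φo)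
      = (c * (j ^ 2 * Ee φe + κ ^ 2 * Eo φo) + Re * κ * (j * κ * Y φe φo))
        + c * (κ ^ 2 * (Fe ψe + Fo ψo)) := by
    linear_combination (-(c * Ee φe)) * hj
  rw [key]
  linarith

/-- Monotonicity in the Reynolds number used to read the criterion (CERT-SHEAR §4 / §10): a family certified at
`R₂` holds at every `0 ≤ R ≤ R₂` provided its dissipation part is non-negative — e.g. the odd sector certified at
`Ro ≥ Re` also gives the plain 2.5-D odd constraint at `Re`. (A restatement of `allRe_transfer` in this file's
shape, for the referee's convenience.) -/
theorem family_monotone_in_R {V W : Type*} (E : V → ℝ) (F : W → ℝ) (X : W → V → ℝ)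
    (hE : ∀ v, 0 ≤ E v) (hF : ∀ w, 0 ≤ F w) {c κ R R₂ : ℝ} (hc : 0 ≤ c) (hR : 0 ≤ R)
    (hle : R ≤ R₂) (H : ∀ (φ : V) (ψ : W), 0 ≤ c * (E φ + F ψ) + R₂ * κ * X ψ φ) :
    ∀ (φ : V) (ψ : W), 0 ≤ c * (E φ + F ψ) + R * κ * X ψ φ := by
  intro φ ψ
  have h := H φ ψ
  have hD : 0 ≤ c * (E φ + F ψ) := mul_nonneg hc (add_nonneg (hE φ) (hF ψ))
  rcases le_or_gt 0 (κ * X ψ φ) with hX | hX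
  · have : 0 ≤ R * (κ * X ψ φ) := mul_nonneg hR hX
    nlinarith
  · have : R₂ * (κ * X ψ φ) ≤ R * (κ * X ψ φ) := by nlinarith
    nlinarith

end Reduction

/-- Scalar bookkeeping of Busse's criterion (RZG25 eq. (χ ≤ 1)): if `0 < Re`, `0 < Ro`, `0 < Rp` and
`Re²·(1/Ro² + 1/Rp²) ≤ 1`, then `s := Re/Ro`, `t := Re/Rp` are admissible split parameters:
`0 < s`, `0 < t`, `s² + t² ≤ 1`, `Ro·s = Re`, `Rp·t = Re`. So the three-family test may be run with the odd sector
at its own critical value `Ro` and the 2-D family at `Rp`. -/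
theorem busse_split_exists {Re Ro Rp : ℝ} (hRe : 0 < Re) (hRo : 0 < Ro) (hRp : 0 < Rp)
    (hchi : Re ^ 2 * (1 / Ro ^ 2 + 1 / Rp ^ 2) ≤ 1) :
    ∃ s t : ℝ, 0 < s ∧ 0 < t ∧ s ^ 2 + t ^ 2 ≤ 1 ∧ Ro * s = Re ∧ Rp * t = Re := by
  refine ⟨Re / Ro, Re / Rp, div_pos hRe hRo, div_pos hRe hRp, ?_, ?_, ?_⟩
  · have h : (Re / Ro) ^ 2 + (Re / Rp) ^ 2 = Re ^ 2 * (1 / Ro ^ 2 + 1 / Rp ^ 2) := by ring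
    rw [h]; exact hchi
  · field_simp
  · field_simp

/-- The criterion in product form (no divisions): `Re²(1/Ro² + 1/Rp²) ≤ 1 ↔ Re²·(Ro² + Rp²) ≤ Ro²·Rp²`
for positive `Ro, Rp` — the shape in which a certificate's scalar file checks it with `norm_num`. -/
theorem busse_criterion_product_form {Re Ro Rp : ℝ} (hRo : 0 < Ro) (hRp : 0 < Rp) :
    Re ^ 2 * (1 / Ro ^ 2 + 1 / Rp ^ 2) ≤ 1 ↔ Re ^ 2 * (Ro ^ 2 + Rp ^ 2) ≤ Ro ^ 2 * Rp ^ 2 := by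
  have hRo2 : 0 < Ro ^ 2 := by positivity
  have hRp2 : 0 < Rp ^ 2 := by positivity
  have h : Re ^ 2 * (1 / Ro ^ 2 + 1 / Rp ^ 2) = Re ^ 2 * (Ro ^ 2 + Rp ^ 2) / (Ro ^ 2 * Rp ^ 2) := by
    field_simp
    ring
  rw [h, div_le_one (mul_pos hRo2 hRp2)]

/-- Scalar core of the wavenumber cutoff of the 2-D poloidal family (CERT-SHEAR §10, Φ-cutoff). After dropping
`16‖p″‖²/κ²` and the mirror terms, what must be shown for a large wavenumber `κ` is
`(4G/κ)·x·y ≤ 8c·x² + c·κ²·y²` (`x = ‖p′‖`, `y = ‖q‖`, `G ≥ sup|g_R|`); it holds for all real `x, y` as soon as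
`G² ≤ 2·c²·κ⁴` (equivalently `κ² ≥ G/(√2·c)`). An instance of `quad_core` with `α = 8cκ`, `β = cκ³`, `T = 2G`. -/
theorem poloidal_free {c κ G : ℝ} (hc : 0 ≤ c) (hκ : 0 < κ) (hcut : G ^ 2 ≤ 2 * c ^ 2 * κ ^ 4) (x y : ℝ) :
    4 * G / κ * x * y ≤ 8 * c * x ^ 2 + c * κ ^ 2 * y ^ 2 := by
  have hα : 0 ≤ 8 * c * κ := by positivity
  have hβ : 0 ≤ c * κ ^ 3 := by positivity
  have hT : (2 * G) ^ 2 ≤ (8 * c * κ) * (c * κ ^ 3) := by nlinarith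
  have h := quad_core hα hβ hT x y
  -- h : 2 * (2G) * x * y ≤ 8cκ x² + cκ³ y² ; divide by κ > 0
  have hκ' : κ ≠ 0 := ne_of_gt hκ
  have goal_mul : κ * (4 * G / κ * x * y) ≤ κ * (8 * c * x ^ 2 + c * κ ^ 2 * y ^ 2) := by
    have e1 : κ * (4 * G / κ * x * y) = 2 * (2 * G) * x * y := by field_simp; ring
    have e2 : κ * (8 * c * x ^ 2 + c * κ ^ 2 * y ^ 2) = 8 * c * κ * x ^ 2 + c * κ ^ 3 * y ^ 2 := by ring
    rw [e1, e2]; exact h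
  exact le_of_mul_le_mul_left goal_mul hκ

/-- Interval rule R-I‴ (monotone–affine), scalar core (CERT-SHEAR §10, INTERIOR CELLS). For ONE fixed test vector the
value of a wavenumber-cell family has the shape `P(τ) + τ·N` with `τ ↦ P(τ)` non-decreasing (all matrix coefficients of
`P` are PSD) and `N` constant. If the two endpoint LMIs of the cell `[a, b]` hold — `0 ≤ P(a) + a·N` (the block at `a`)
and `0 ≤ P(a) + b·N` (the MIXED block) — then the value is non-negative at every `τ ∈ [a, b]`: here `Pa = P(a)`,
`Pτ = P(τ)` with `Pa ≤ Pτ`. Proof: `P(τ) + τN ≥ P(a) + τN`, and an affine function of `τ` non-negative at both ends of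
the cell is non-negative on it. -/
theorem interval_rule_monotone_affine {Pa Pτ N a b τ : ℝ} (ha : a ≤ τ) (hb : τ ≤ b) (hmono : Pa ≤ Pτ)
    (h₁ : 0 ≤ Pa + a * N) (h₂ : 0 ≤ Pa + b * N) : 0 ≤ Pτ + τ * N := by
  rcases le_or_gt 0 N with hN | hN
  · -- N ≥ 0: τ·N ≥ a·N
    have : a * N ≤ τ * N := mul_le_mul_of_nonneg_right ha hN
    linarith
  · -- N < 0: τ·N ≥ b·N
    have : b * N ≤ τ * N := by nlinarith
    linarith

/-- The same rule stated for a whole family of test vectors (index `i`), which is how a cell certificate is read: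
two certified endpoint blocks ⇒ the family holds on the whole cell. -/
theorem interval_rule_monotone_affine_forall {ι : Type*} (Pa Pτ N : ι → ℝ) {a b τ : ℝ} (ha : a ≤ τ) (hb : τ ≤ b)
    (hmono : ∀ i, Pa i ≤ Pτ i) (h₁ : ∀ i, 0 ≤ Pa i + a * N i) (h₂ : ∀ i, 0 ≤ Pa i + b * N i) :
    ∀ i, 0 ≤ Pτ i + τ * N i :=
  fun i => interval_rule_monotone_affine ha hb (hmono i) (h₁ i) (h₂ i)

end Summit.NavierStokesRegularity.TurbBounds
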